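import Mathlib
import HarnessLib.Audit
import Summits.PneNP.PneNP.Theorems.PstarForcing
import Summits.PneNP.PneNP.Theorems.PstarLagrangian
import Summits.PneNP.PneNP.Theorems.PstarUnionBridge

/-!
# Case A of the union lemma: the rank-four flat lemma (R4) and no free bridge (ROUND-24, memo §14.16–§14.18; ASK T-UNION-TRI)

FRONTIER range-avoidance ladder, rung F-N3, ROUND 24 (cell `pnp-ideate`, planner memo `r24/CORE-BOUND-NOTES.md` §14.16–§14.18, typed sketch `r24/SketchCaseA.lean` of planner
p3 g22 — statements (R4) and `no_free_bridge` VERBATIM; restricted-model proof complexity — nothing here bears on `P` versus `NP`).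

* `rank_le_four_of_const_on_flat` — **(R4)**: a quadratic function constant on a non-empty flat `{l₁ = 1, l₂ = 1}` of codimension `≤ 2` has polar rank `≤ 4`
  (`finrank M ≤ finrank (rad B) + 4`): its polar form vanishes on the direction space `W = ker lin l₁ ∩ ker lin l₂`, so `x ↦ B x ·` maps `W` into the dual
  annihilator of `W` (dimension `= codim W ≤ 2`) with kernel inside `rad B`;
* `no_free_bridge` — the cover form of A5 (`PstarUnionBridge.satPair_of_erase_bridge`): in a union-terminal core no output has a side read evenly by
  `A₀`, `A₁` and `w₂`.

(R6), forcing in rank six, follows in `PstarUnionRankSix`.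
-/

set_option linter.dupNamespace false -- `Summit.PneNP.PneNP.…`: summit = sub-problem name (D-0017 single-conjunct layout)

open Finset Module Literature.Computability.Complexity
open Summit.PneNP.PneNP.Theorems.PstarCubeIdeals (IsAffineFn IsQuadFn)
open Summit.PneNP.PneNP.Theorems.PstarQuadRank (rad mem_rad)
open Summit.PneNP.PneNP.Theorems.PstarRankRigidityTwo (linPart linPart_apply)
open Summit.PneNP.PneNP.Theorems.PstarLagrangian (finrank_le_finrank_inf_ker_add_one)
open Summit.PneNP.PneNP.Theorems.PstarGapOneAll (gval)
open Summit.PneNP.PneNP.Theorems.PstarUnion (SatPair UnionTerminal)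
open Summit.PneNP.PneNP.Theorems.PstarUnionBridge (satPair_of_erase_bridge)

namespace Summit.PneNP.PneNP.Theorems.PstarUnionCaseA

section rank

variable {M : Type*} [AddCommGroup M] [Module (ZMod 2) M] [Fintype M]

/-- In `𝔽₂`, `x + x = 0`. -/
private theorem zmod2_add_self (x : ZMod 2) : x + x = 0 := by
  revert x; decide

omit [Fintype M] in
/-- The second-difference identity: `Q(h+x+w) + Q(h+x) + Q(h+w) + Q(h) = B x w`. -/
theorem second_difference {Q : M → ZMod 2} {B : LinearMap.BilinForm (ZMod 2) M} (hB : ∀ x w, Q (x + w) = Q x + Q w + Q 0 + B x w) (h x w : M) :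
    Q (h + x + w) + Q (h + x) + Q (h + w) + Q h = B x w := by
  rw [hB (h + x) w, hB h x, hB h w, map_add B h x, LinearMap.add_apply]
  linear_combination 2 * zmod2_add_self (Q h) + zmod2_add_self (Q x) + 2 * zmod2_add_self (Q 0) + zmod2_add_self (B h x) +
    zmod2_add_self (Q w) + zmod2_add_self (B h w)

/-- **(R4)** A quadratic function constant on a non-empty flat of codimension at most two has polar rank at most four. -/
theorem rank_le_four_of_const_on_flat {Q : M → ZMod 2} {B : LinearMap.BilinForm (ZMod 2) M}
    (hB : ∀ x w, Q (x + w) = Q x + Q w + Q 0 + B x w)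
    {l₁ l₂ : M → ZMod 2} (h₁ : IsAffineFn l₁) (h₂ : IsAffineFn l₂)
    (hne : ∃ h, l₁ h = 1 ∧ l₂ h = 1)
    (hconst : ∀ x x', l₁ x = 1 → l₂ x = 1 → l₁ x' = 1 → l₂ x' = 1 → Q x = Q x') :
    finrank (ZMod 2) M ≤ finrank (ZMod 2) (rad B) + 4 := by
  classical
  haveI : Module.Finite (ZMod 2) M := Module.Finite.of_finite
  obtain ⟨h, hh₁, hh₂⟩ := hne
  -- the direction space of the flat
  set W : Submodule (ZMod 2) M := (⊤ ⊓ LinearMap.ker (linPart h₁)) ⊓ LinearMap.ker (linPart h₂) with hW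
  have hWmem : ∀ {x : M}, x ∈ W → l₁ x = l₁ 0 ∧ l₂ x = l₂ 0 := by
    intro x hx
    rw [hW, Submodule.mem_inf, Submodule.mem_inf, LinearMap.mem_ker, LinearMap.mem_ker, linPart_apply, linPart_apply] at hx
    have e : ∀ a b : ZMod 2, a + b = 0 → a = b := by decide
    exact ⟨e _ _ hx.1.2, e _ _ hx.2⟩
  -- translating the base point by `W` stays in the flat
  have hflat : ∀ {x : M}, x ∈ W → l₁ (h + x) = 1 ∧ l₂ (h + x) = 1 := by
    intro x hx
    obtain ⟨e1, e2⟩ := hWmem hx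
    rw [h₁ h x, h₂ h x, hh₁, hh₂, e1, e2, add_assoc, zmod2_add_self, add_zero, add_assoc, zmod2_add_self, add_zero]
    exact ⟨rfl, rfl⟩
  -- `B` vanishes on `W × W`
  have hiso : ∀ x ∈ W, ∀ w ∈ W, B x w = 0 := by
    intro x hx w hw
    rw [← second_difference hB h x w]
    have hxw : x + w ∈ W := W.add_mem hx hw
    have e0 := hconst _ _ (hflat hxw).1 (hflat hxw).2 hh₁ hh₂
    have e1 := hconst _ _ (hflat hx).1 (hflat hx).2 hh₁ hh₂
    have e2 := hconst _ _ (hflat hw).1 (hflat hw).2 hh₁ hh₂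
    rw [show h + x + w = h + (x + w) from add_assoc h x w, e0, e1, e2]
    linear_combination 2 * zmod2_add_self (Q h)
  -- dimension of `W`: codimension at most two
  have hdimW : finrank (ZMod 2) M ≤ finrank (ZMod 2) W + 2 := by
    have a := finrank_le_finrank_inf_ker_add_one (⊤ : Submodule (ZMod 2) M) (linPart h₁)
    have b := finrank_le_finrank_inf_ker_add_one (⊤ ⊓ LinearMap.ker (linPart h₁)) (linPart h₂)
    rw [finrank_top] at a
    rw [hW]; omega
  -- `x ↦ B x` maps `W` into the dual annihilator of `W`, with kernel inside `rad B`
  set ψ : W →ₗ[ZMod 2] Module.Dual (ZMod 2) M := B.domRestrict W with hψ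
  have hrange : LinearMap.range ψ ≤ W.dualAnnihilator := by
    rintro φ ⟨x, rfl⟩
    rw [Submodule.mem_dualAnnihilator]
    intro w hw
    exact hiso x x.2 w hw
  have hker : finrank (ZMod 2) (LinearMap.ker ψ) ≤ finrank (ZMod 2) (rad B) := by
    have hle : (LinearMap.ker ψ).map W.subtype ≤ rad B := by
      rintro v ⟨x, hx, rfl⟩
      rw [SetLike.mem_coe, LinearMap.mem_ker] at hx
      rw [mem_rad]
      intro y
      have := congrArg (fun φ : Module.Dual (ZMod 2) M => φ y) hx
      simpa [hψ] using this
    rw [← Submodule.finrank_map_subtype_eq W (LinearMap.ker ψ)]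
    exact Submodule.finrank_mono hle
  have hrn := LinearMap.finrank_range_add_finrank_ker ψ
  have hann := Subspace.finrank_add_finrank_dualAnnihilator_eq W
  have hr := Submodule.finrank_mono hrange
  omega

end rank

section cover

variable {n m : ℕ}

/-- **No free bridge (cover form of A5).**  Under the union-terminal cover, an output `e ∈ J₀` with a side `S` (odd for `e`, even for every other output
of `J₀`, no AND variable inside) on which `A₀`, `A₁` and `w₂` all read evenly cannot exist. -/
theorem no_free_bridge (I : LocalMap 4 n m) (hI : I.IsPure xorAndPred) {r : ℕ} (y : Fin m → Bool) {J₀ : Finset (Fin m)}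
    {A₀ A₁ w₂ : Finset (Fin n) × Finset (Fin m) × Bool} (hU : UnionTerminal I r y J₀ A₀ A₁ w₂)
    {e : Fin m} (he : e ∈ J₀) (S : Finset (Fin n))
    (hodd : Odd ((univ.filter fun s : Fin 4 => s.val < 2 ∧ I.vars e s ∈ S).card))
    (heven : ∀ j ∈ J₀, j ≠ e → Even ((univ.filter fun s : Fin 4 => s.val < 2 ∧ I.vars j s ∈ S).card))
    (hand : ∀ j : Fin m, I.vars j 2 ∉ S ∧ I.vars j 3 ∉ S)
    (hA₀ : Even ((A₀.1 ∩ S).card)) (hA₁ : Even ((A₁.1 ∩ S).card)) (hw : Even ((w₂.1 ∩ S).card)) : False := by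
  obtain ⟨-, -, -, -, -, -, -, -, h₀, h₁, hcov⟩ := hU
  rcases hcov e he with h | h
  · exact h₀ (satPair_of_erase_bridge I hI he S hodd heven hand A₀ w₂ hA₀ hw h)
  · exact h₁ (satPair_of_erase_bridge I hI he S hodd heven hand A₁ w₂ hA₁ hw h)

end cover

end Summit.PneNP.PneNP.Theorems.PstarUnionCaseA
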